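import Mathlib.Analysis.InnerProductSpace.PiL2
import Literature.Computability.QuantumComplexity.StabilizerSimulation
import HarnessLib

/-!
# Stabilizer-rank simulation — the Sparsification Lemma and Theorem 1 of Bravyi et al. (2019)

Discharge of the named fact `BravyiEtAl2019_thm1` of
`Literature.Computability.QuantumComplexity.StabilizerSimulation` (kept in a sibling file so that
the statement file stays a definitions/named-facts file with light imports; the other discharged
facts of that file live in `StabilizerSimulationProofs`):

* `BravyiEtAl2019_thm1_holds` — **sparsification bound** (Bravyi–Browne–Calpin–Campbell–Gosset–
  Howard 2019, §2.1 Theorem 1): a unit vector `ψ = ∑_α c_α φ_α` with normalized stabilizer states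
  `φ_α` has `χ_δ(ψ) ≤ 1 + ‖c‖₁²/δ²` for every `δ > 0` (the tree's form of the printed
  `χ_δ(ψ) ≤ ‖c‖₁²/δ²`; the `1 +` absorbs the rounding of the number of samples to an integer);
* `BravyiEtAl2019_thm1_sharp` — the printed bound `χ_δ(ψ) ≤ ‖c‖₁²/δ²` verbatim, which also
  holds for the tree's definitions (see its docstring);
* `exists_stabilizerRank_le_normSq_sub_le` — the **Sparsification Lemma** (§5.2, Lemma 6) in
  derandomized form: for every `m ≥ 1` there is a combination `Ω` of `m` stabilizer states with
  `‖ψ - Ω‖² ≤ (‖c‖₁² - 1)/m`.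

## Proof architecture (all proved here)

The source proves Theorem 1 from Lemma 6 by the probabilistic method: with
`p_j = |c_j|/‖c‖₁`, `ω_j = (c_j/|c_j|) φ_j` (so `ψ = ‖c‖₁ ∑_j p_j ω_j`) and `m` i.i.d. samples,
`Ω = (‖c‖₁/m) ∑_a ω_a` satisfies `E‖ψ - Ω‖² = E⟨Ω|Ω⟩ - 1 ≤ ‖c‖₁²/m` (the printed second-moment
computation; its exact value is `(‖c‖₁² - 1)/m`), hence some sample is `δ`-close to `ψ` once
`m ≥ ‖c‖₁²/δ²`, and it is manifestly a sum of `m` stabilizer states. To avoid product probability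
spaces we run the *same* second-moment identity one sample at a time (method of conditional
expectations):

* `sum_mul_norm_add_sq_eq` / `sum_mul_normSq_add_eq` — the bias–variance identity
  `∑_j p_j ‖R + Y_j‖² = ‖R‖² + ∑_j p_j ‖Y_j‖²` whenever `∑ p_j = 1`, `∑ p_j Y_j = 0` (expand
  `‖R + Y‖² = ‖R‖² + 2 Re⟨R, Y⟩ + ‖Y‖²`; the cross terms cancel), in a complex inner product space
  and transferred to the tree's `normSq` through `EuclideanSpace ℂ (QReg n)`
  (`normSq_eq_norm_toLp_sq`);
* with `Y_j = ‖c‖₁ ω_j - ψ` (so `∑ p_j Y_j = 0` and, by the identity at `R = ψ`,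
  `V := ∑ p_j ‖Y_j‖² = ‖c‖₁² - ‖ψ‖² = ‖c‖₁² - 1`), averaging over the support of `p` yields at
  each step an index `j` with `‖R + Y_j‖² ≤ ‖R‖² + V`; after `m` greedy steps
  `‖∑_a Y_{j_a}‖² ≤ m V`, and
  `Ω := ψ + (1/m) ∑_a Y_{j_a} = ∑_a (‖c‖₁ c_{j_a} / (m |c_{j_a}|)) φ_{j_a}` has `χ(Ω) ≤ m` and
  `‖ψ - Ω‖² ≤ V/m` (`exists_stabilizerRank_le_normSq_sub_le`);
* Theorem 1: `m = ⌊‖c‖₁²/δ²⌋ + 1` samples (`BravyiEtAl2019_thm1_holds`); for the verbatim bound,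
  `χ_δ(ψ) = 0` when `δ ≥ 1` and otherwise `m = ⌊‖c‖₁²/δ²⌋ ≥ 1` samples suffice because the
  error is `(‖c‖₁² - 1)/m` rather than `‖c‖₁²/m` (`BravyiEtAl2019_thm1_sharp`).

## Mathlib / tree reuse

Mathlib: `EuclideanSpace`, `EuclideanSpace.norm_sq_eq`, `WithLp.toLp_add/_sum/_smul`,
`norm_add_sq`, `inner_sum`, `inner_smul_right`, `Finset.exists_le_of_sum_le`,
`Finset.sum_filter_of_ne`, `Nat.floor_le`, `Nat.lt_floor_add_one`, `Nat.floor_pos`,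
`Matrix.vecCons`/`Fin.sum_univ_succ`, `Nat.sInf_le`. Tree: `stabilizerStates`, `stabilizerRank`,
`approxStabilizerRank`, `stabilizerRank_zero`, `Cryptography.normSq`. No new definitions and no
new named facts are introduced.

## References

* S. Bravyi, D. Browne, P. Calpin, E. Campbell, D. Gosset, M. Howard, *Simulation of quantum
  circuits by low-rank stabilizer decompositions*, Quantum 3 (2019) 181, arXiv:1808.00128
  (doi:10.22331/q-2019-09-02-181): §2.1 Def. 2 (`χ_δ`) and Theorem 1 (`χ_δ(ψ) ≤ ‖c‖₁²/δ²`, "the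
  stabilizer decomposition does not have to be optimal"); §5.2 Lemma 6 (Sparsification:
  `Ω = (‖c‖₁/k) ∑_{α≤k} ω_α`, `E‖ψ - Ω‖² = ‖c‖₁²/k`) and its proof (`p_j = |c_j|/‖c‖₁`,
  `W_j = (c_j/|c_j|) φ_j`, `E⟨Ω|Ω⟩ ≤ 1 + ‖c‖₁²/k`), and the paragraph after Lemma 6 deriving
  Theorem 1 ("choosing `k = (‖c‖₁/δ)²` … there exists at least one `Ω` (which is manifestly a sum
  of `k` stabilizer states) that `δ`-approximates `ψ`").
-/

noncomputable section

open Matrix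
open scoped InnerProductSpace

namespace Literature.Computability.QuantumComplexity

section Sparsification

variable {n : ℕ}

/-- `normSq` is the squared norm of `EuclideanSpace ℂ (QReg n)` (transfer lemma). [folklore] -/
theorem normSq_eq_norm_toLp_sq (ψ : Cryptography.QReg n → ℂ) :
    Cryptography.normSq ψ = ‖WithLp.toLp 2 ψ‖ ^ 2 := by
  rw [EuclideanSpace.norm_sq_eq]
  rfl

/-- `normSq (a • ψ) = ‖a‖² · normSq ψ`. [folklore] -/
theorem normSq_const_smul (a : ℂ) (ψ : Cryptography.QReg n → ℂ) :
    Cryptography.normSq (a • ψ) = ‖a‖ ^ 2 * Cryptography.normSq ψ := by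
  simp only [Cryptography.normSq, Pi.smul_apply, smul_eq_mul, norm_mul, mul_pow, Finset.mul_sum]

/-- **Bias–variance identity** in a complex inner product space: if the real weights `p_i` sum to
`1` and `∑ p_i Y_i = 0`, then `∑ p_i ‖R + Y_i‖² = ‖R‖² + ∑ p_i ‖Y_i‖²` for every `R`. [folklore] -/
theorem sum_mul_norm_add_sq_eq {E : Type*} [NormedAddCommGroup E] [InnerProductSpace ℂ E]
    {ι : Type*} (s : Finset ι) (p : ι → ℝ) (Y : ι → E) (R : E)
    (hp : ∑ i ∈ s, p i = 1) (hY : ∑ i ∈ s, (p i : ℂ) • Y i = 0) :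
    ∑ i ∈ s, p i * ‖R + Y i‖ ^ 2 = ‖R‖ ^ 2 + ∑ i ∈ s, p i * ‖Y i‖ ^ 2 := by
  have hcross : ∑ i ∈ s, p i * (⟪R, Y i⟫_ℂ).re = 0 := by
    have h : (⟪R, ∑ i ∈ s, (p i : ℂ) • Y i⟫_ℂ).re = ∑ i ∈ s, p i * (⟪R, Y i⟫_ℂ).re := by
      rw [inner_sum, Complex.re_sum]
      refine Finset.sum_congr rfl fun i _ => ?_
      rw [inner_smul_right, Complex.re_ofReal_mul]
    rw [← h, hY, inner_zero_right, Complex.zero_re]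
  have hterm : ∀ i ∈ s, p i * ‖R + Y i‖ ^ 2 =
      p i * ‖R‖ ^ 2 + 2 * (p i * (⟪R, Y i⟫_ℂ).re) + p i * ‖Y i‖ ^ 2 := by
    intro i _
    rw [norm_add_sq (𝕜 := ℂ), RCLike.re_to_complex]
    ring
  rw [Finset.sum_congr rfl hterm, Finset.sum_add_distrib, Finset.sum_add_distrib,
    ← Finset.sum_mul, hp, one_mul, ← Finset.mul_sum, hcross, mul_zero, add_zero]

/-- The bias–variance identity for state vectors and `normSq`. [folklore] -/
theorem sum_mul_normSq_add_eq {ι : Type*} (s : Finset ι) (p : ι → ℝ)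
    (Y : ι → Cryptography.QReg n → ℂ) (R : Cryptography.QReg n → ℂ)
    (hp : ∑ i ∈ s, p i = 1) (hY : ∑ i ∈ s, (p i : ℂ) • Y i = 0) :
    ∑ i ∈ s, p i * Cryptography.normSq (R + Y i) =
      Cryptography.normSq R + ∑ i ∈ s, p i * Cryptography.normSq (Y i) := by
  simp only [normSq_eq_norm_toLp_sq, WithLp.toLp_add]
  refine sum_mul_norm_add_sq_eq s p _ _ hp ?_
  have h : ∑ i ∈ s, (p i : ℂ) • WithLp.toLp 2 (Y i) = WithLp.toLp 2 (∑ i ∈ s, (p i : ℂ) • Y i) := by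
    rw [WithLp.toLp_sum]
    rfl
  rw [h, hY, WithLp.toLp_zero]

/-- **Derandomized Sparsification Lemma** (Bravyi et al. 2019, §5.2, Lemma 6 and the proof of
Theorem 1). Let `ψ = ∑_{i<k} c_i φ_i` be a unit vector with `φ_i` normalized stabilizer states.
For every `m ≥ 1` there is a linear combination `Ω` of `m` stabilizer states (so `χ(Ω) ≤ m`) with
`‖ψ - Ω‖² ≤ (‖c‖₁² - 1)/m`. Printed form: a random `Ω = (‖c‖₁/m) ∑_{a≤m} ω_a` has
`E ‖ψ - Ω‖² = E⟨Ω|Ω⟩ - 1 ≤ ‖c‖₁²/m`, hence some sample achieves the mean; here the samples are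
chosen greedily one at a time using `sum_mul_normSq_add_eq`, with `p_j = |c_j|/‖c‖₁`,
`ω_j = (c_j/|c_j|) φ_j`, `Y_j = ‖c‖₁ ω_j - ψ`, `∑_j p_j ‖Y_j‖² = ‖c‖₁² - ‖ψ‖² = ‖c‖₁² - 1`.
[cite: BravyiEtAl2019, §5.2 Lemma 6] -/
theorem exists_stabilizerRank_le_normSq_sub_le {k : ℕ} (ψ : Cryptography.QReg n → ℂ)
    (hψ : Cryptography.normSq ψ = 1) (c : Fin k → ℂ) (φ : Fin k → Cryptography.QReg n → ℂ)
    (hφ : ∀ i, φ i ∈ stabilizerStates n) (hφ₁ : ∀ i, Cryptography.normSq (φ i) = 1)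
    (hdec : ψ = ∑ i, c i • φ i) {m : ℕ} (hm : 0 < m) :
    ∃ Ω : Cryptography.QReg n → ℂ, stabilizerRank Ω ≤ m ∧
      Cryptography.normSq (ψ - Ω) ≤ ((∑ i, ‖c i‖) ^ 2 - 1) / m := by
  classical
  -- the `ℓ¹` norm of the coefficients
  set L : ℝ := ∑ i, ‖c i‖ with hL
  have hL0 : 0 ≤ L := Finset.sum_nonneg fun i _ => norm_nonneg _
  rcases hL0.eq_or_lt with hL0' | hLpos
  · -- `‖c‖₁ = 0`: every coefficient vanishes and `ψ = 0`, contradicting `‖ψ‖ = 1`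
    exfalso
    have hc : ∀ i, c i = 0 := fun i => norm_eq_zero.1
      ((Finset.sum_eq_zero_iff_of_nonneg fun i _ => norm_nonneg (c i)).1 hL0'.symm i
        (Finset.mem_univ i))
    have hψ0 : ψ = 0 := by
      rw [hdec]
      exact Finset.sum_eq_zero fun i _ => by rw [hc i, zero_smul]
    rw [hψ0] at hψ
    simp [Cryptography.normSq] at hψ
  -- `‖c‖₁ > 0`: weights `p`, phase-normalised states `u`, centred vectors `Y`
  have hLne : (L : ℂ) ≠ 0 := by exact_mod_cast hLpos.ne'
  set p : Fin k → ℝ := fun i => ‖c i‖ / L with hp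
  set u : Fin k → Cryptography.QReg n → ℂ := fun i => (c i / (‖c i‖ : ℂ)) • φ i with hu
  set Y : Fin k → Cryptography.QReg n → ℂ := fun i => (L : ℂ) • u i - ψ with hY
  have hp1 : ∑ i, p i = 1 := by
    simp only [hp]
    rw [← Finset.sum_div, div_self hLpos.ne']
  have hpc : ∀ i, c i = 0 → p i = 0 := fun i h => by simp [hp, h]
  -- `p_i • (L • u_i) = c_i • φ_i`
  have hpL : ∀ i, (p i : ℂ) • ((L : ℂ) • u i) = c i • φ i := by
    intro i
    simp only [hu, smul_smul]
    by_cases hci : c i = 0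
    · simp [hpc i hci, hci]
    · congr 1
      have h1 : (‖c i‖ : ℂ) ≠ 0 := by exact_mod_cast (norm_ne_zero_iff.2 hci)
      simp only [hp, Complex.ofReal_div]
      field_simp
  -- `∑ p_i Y_i = 0`
  have hYsum : ∑ i, (p i : ℂ) • Y i = 0 := by
    simp only [hY, smul_sub, Finset.sum_sub_distrib, hpL, ← Finset.sum_smul]
    rw [← hdec, ← Complex.ofReal_sum, hp1, Complex.ofReal_one, one_smul, sub_self]
  -- the variance `V = ∑ p_i ‖Y_i‖² = L² - 1`
  set V : ℝ := ∑ i, p i * Cryptography.normSq (Y i) with hV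
  have hVeq : V = L ^ 2 - 1 := by
    have key := sum_mul_normSq_add_eq Finset.univ p Y ψ hp1 hYsum
    have hterm : ∀ i, p i * Cryptography.normSq (ψ + Y i) = p i * L ^ 2 := by
      intro i
      by_cases hci : c i = 0
      · simp [hpc i hci]
      · have hadd : ψ + Y i = (L : ℂ) • u i := by simp [hY]
        have hnu : ‖c i / (‖c i‖ : ℂ)‖ = 1 := by
          rw [norm_div, Complex.norm_real, Real.norm_eq_abs, abs_norm,
            div_self (norm_ne_zero_iff.2 hci)]
        rw [hadd, normSq_const_smul, hu]
        simp only
        rw [normSq_const_smul, hnu, hφ₁ i, Complex.norm_real, Real.norm_eq_abs, sq_abs]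
        ring
    have hsum : ∑ i, p i * Cryptography.normSq (ψ + Y i) = L ^ 2 := by
      rw [Finset.sum_congr rfl fun i _ => hterm i, ← Finset.sum_mul, hp1, one_mul]
    rw [hsum, hψ] at key
    linarith
  -- greedy (derandomized) sampling: `m` indices with `‖∑_j Y_{s j}‖² ≤ m V`
  have claim : ∀ m : ℕ, ∃ s : Fin m → Fin k,
      Cryptography.normSq (∑ j, Y (s j)) ≤ m * V := by
    intro m
    induction m with
    | zero =>
      refine ⟨Fin.elim0, ?_⟩
      simp [Cryptography.normSq]
    | succ m ih =>
      obtain ⟨s, hs⟩ := ih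
      set R : Cryptography.QReg n → ℂ := ∑ j, Y (s j) with hR
      have havg := sum_mul_normSq_add_eq Finset.univ p Y R hp1 hYsum
      -- restrict the averaging identity to the support of `p`
      set S : Finset (Fin k) := Finset.univ.filter fun i => c i ≠ 0 with hS
      have hSne : S.Nonempty := by
        obtain ⟨i, -, hi⟩ :=
          Finset.exists_ne_zero_of_sum_ne_zero (hL ▸ hLpos.ne' : ∑ i, ‖c i‖ ≠ 0)
        exact ⟨i, Finset.mem_filter.2 ⟨Finset.mem_univ i, norm_ne_zero_iff.1 hi⟩⟩
      have hle : ∑ i ∈ S, p i * Cryptography.normSq (R + Y i) ≤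
          ∑ i ∈ S, p i * (Cryptography.normSq R + V) := by
        rw [hS, Finset.sum_filter_of_ne, Finset.sum_filter_of_ne, havg, ← Finset.sum_mul, hp1,
          one_mul]
        · intro i _ h
          contrapose! h
          rw [hpc i h, zero_mul]
        · intro i _ h
          contrapose! h
          rw [hpc i h, zero_mul]
      obtain ⟨i, hiS, hi⟩ := Finset.exists_le_of_sum_le hSne hle
      have hci : c i ≠ 0 := (Finset.mem_filter.1 hiS).2
      have hpi : 0 < p i := div_pos (norm_pos_iff.2 hci) hLpos
      have hi' : Cryptography.normSq (R + Y i) ≤ Cryptography.normSq R + V :=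
        le_of_mul_le_mul_left hi hpi
      refine ⟨Matrix.vecCons i s, ?_⟩
      rw [Fin.sum_univ_succ]
      simp only [Matrix.cons_val_zero, Matrix.cons_val_succ]
      rw [add_comm, ← hR]
      push_cast
      linarith
  -- `m` samples
  have hmR : (0 : ℝ) < m := by exact_mod_cast hm
  have hmC : (m : ℂ) ≠ 0 := by exact_mod_cast hm.ne'
  obtain ⟨s, hs⟩ := claim m
  set R : Cryptography.QReg n → ℂ := ∑ j, Y (s j) with hR
  -- the sparse approximant `Ω = ψ + R/m = (L/m) ∑_j u_{s j}`
  set Ω : Cryptography.QReg n → ℂ := ψ + ((m : ℂ))⁻¹ • R with hΩ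
  have hΩdec : Ω = ∑ j, ((m : ℂ)⁻¹ * (L : ℂ) * (c (s j) / (‖c (s j)‖ : ℂ))) • φ (s j) := by
    have hR' : R = (∑ j, (L : ℂ) • u (s j)) - (m : ℂ) • ψ := by
      simp only [hR, hY, Finset.sum_sub_distrib, Finset.sum_const, Finset.card_univ,
        Fintype.card_fin, ← Nat.cast_smul_eq_nsmul ℂ]
    rw [hΩ, hR', smul_sub, smul_smul, inv_mul_cancel₀ hmC, one_smul, add_sub_cancel,
      Finset.smul_sum]
    refine Finset.sum_congr rfl fun j _ => ?_
    simp only [hu, smul_smul, mul_assoc]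
  refine ⟨Ω, Nat.sInf_le ⟨fun j => (m : ℂ)⁻¹ * (L : ℂ) * (c (s j) / (‖c (s j)‖ : ℂ)),
    fun j => φ (s j), fun j => hφ (s j), hΩdec⟩, ?_⟩
  -- the approximation error `‖ψ - Ω‖² = ‖R‖²/m² ≤ V/m = (L² - 1)/m`
  have hdiff : ψ - Ω = (-((m : ℂ))⁻¹) • R := by
    rw [hΩ, neg_smul]
    abel
  rw [hdiff, normSq_const_smul, norm_neg, norm_inv, Complex.norm_natCast, inv_pow,
    inv_mul_le_iff₀ (by positivity), ← hVeq]
  calc Cryptography.normSq R ≤ m * V := hs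
    _ = (m : ℝ) ^ 2 * (V / m) := by
      field_simp

/-- **Discharge of `BravyiEtAl2019_thm1`** (Bravyi–Browne–Calpin–Campbell–Gosset–Howard 2019,
Theorem 1: `χ_δ(ψ) ≤ ‖c‖₁²/δ²`, proved in §5.2 from the Sparsification Lemma 6; the tree's
statement records the bound `1 + ‖c‖₁²/δ²`, which absorbs the rounding of the number of samples
to an integer). Proof: `exists_stabilizerRank_le_normSq_sub_le` with `m = ⌊‖c‖₁²/δ²⌋ + 1`
samples gives `Ω` with `χ(Ω) ≤ m ≤ 1 + ‖c‖₁²/δ²` and `‖ψ - Ω‖² ≤ (‖c‖₁² - 1)/m ≤ ‖c‖₁²/m ≤ δ²`.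
[cite: BravyiEtAl2019, Thm. 1 and §5.2 Lemma 6] -/
theorem BravyiEtAl2019_thm1_holds : BravyiEtAl2019_thm1 := by
  intro n k ψ hψ c φ hφ hφ₁ hdec δ hδ
  set L : ℝ := ∑ i, ‖c i‖ with hL
  set m : ℕ := ⌊L ^ 2 / δ ^ 2⌋₊ + 1 with hm
  have hm0 : 0 < m := Nat.succ_pos _
  have hmR : (0 : ℝ) < m := by exact_mod_cast hm0
  have hmle : (m : ℝ) ≤ 1 + L ^ 2 / δ ^ 2 := by
    rw [hm]
    push_cast
    linarith [Nat.floor_le (by positivity : 0 ≤ L ^ 2 / δ ^ 2)]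
  have hmlt : L ^ 2 / δ ^ 2 < m := by
    rw [hm]
    push_cast
    exact Nat.lt_floor_add_one _
  obtain ⟨Ω, hrank, hclose⟩ := exists_stabilizerRank_le_normSq_sub_le ψ hψ c φ hφ hφ₁ hdec hm0
  have hclose' : Cryptography.normSq (ψ - Ω) ≤ δ ^ 2 := by
    refine hclose.trans ?_
    rw [div_le_iff₀ hmR]
    rw [div_lt_iff₀ (pow_pos hδ 2)] at hmlt
    linarith
  have happrox : approxStabilizerRank δ ψ ≤ stabilizerRank Ω := Nat.sInf_le ⟨Ω, hclose', rfl⟩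
  calc (approxStabilizerRank δ ψ : ℝ) ≤ m := by exact_mod_cast happrox.trans hrank
    _ ≤ 1 + (∑ i, ‖c i‖) ^ 2 / δ ^ 2 := hL ▸ hmle

/-- **Theorem 1 of Bravyi et al. 2019, verbatim bound** `χ_δ(ψ) ≤ ‖c‖₁²/δ²` (without the
rounding slack `1 +` of `BravyiEtAl2019_thm1`). It follows from the exact second moment
`(‖c‖₁² - 1)/m` of `exists_stabilizerRank_le_normSq_sub_le`: if `δ ≥ 1` then `χ_δ(ψ) = 0`
(`Ω = 0` is `δ`-close to the unit vector `ψ`); otherwise `‖c‖₁ ≥ ‖ψ‖ = 1` gives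
`x = ‖c‖₁²/δ² ≥ 1`, and `m = ⌊x⌋ ≥ 1` samples suffice because
`(‖c‖₁² - 1)/m ≤ δ²` iff `x - 1/δ² ≤ m`, while `x - 1/δ² < x - 1 < ⌊x⌋`.
[cite: BravyiEtAl2019, Thm. 1] -/
theorem BravyiEtAl2019_thm1_sharp {k : ℕ} (ψ : Cryptography.QReg n → ℂ)
    (hψ : Cryptography.normSq ψ = 1) (c : Fin k → ℂ) (φ : Fin k → Cryptography.QReg n → ℂ)
    (hφ : ∀ i, φ i ∈ stabilizerStates n) (hφ₁ : ∀ i, Cryptography.normSq (φ i) = 1)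
    (hdec : ψ = ∑ i, c i • φ i) (δ : ℝ) (hδ : 0 < δ) :
    (approxStabilizerRank δ ψ : ℝ) ≤ (∑ i, ‖c i‖) ^ 2 / δ ^ 2 := by
  set L : ℝ := ∑ i, ‖c i‖ with hL
  have hδ2 : 0 < δ ^ 2 := pow_pos hδ 2
  rcases le_or_gt 1 (δ ^ 2) with hδ1 | hδ1
  · -- `δ ≥ 1`: the zero vector is `δ`-close, `χ_δ(ψ) = 0`
    have hzero : Cryptography.normSq (ψ - 0) ≤ δ ^ 2 := by rwa [sub_zero, hψ]
    have h0 : approxStabilizerRank δ ψ ≤ stabilizerRank (0 : Cryptography.QReg n → ℂ) :=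
      Nat.sInf_le ⟨0, hzero, rfl⟩
    rw [stabilizerRank_zero] at h0
    have h0' : (approxStabilizerRank δ ψ : ℝ) ≤ 0 := by exact_mod_cast h0
    exact h0'.trans (by positivity)
  · -- `δ < 1`
    -- `‖c‖₁² ≥ 1` (one sample: `0 ≤ ‖ψ - Ω‖² ≤ ‖c‖₁² - 1`)
    have hL1 : 1 ≤ L ^ 2 := by
      obtain ⟨Ω, -, hΩ⟩ :=
        exists_stabilizerRank_le_normSq_sub_le ψ hψ c φ hφ hφ₁ hdec Nat.one_pos
      have h0 : 0 ≤ Cryptography.normSq (ψ - Ω) := Finset.sum_nonneg fun _ _ => by positivity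
      rw [Nat.cast_one, div_one] at hΩ
      linarith
    set x : ℝ := L ^ 2 / δ ^ 2 with hx
    have hx1 : 1 ≤ x := by
      rw [hx, le_div_iff₀ hδ2]
      linarith
    set m : ℕ := ⌊x⌋₊ with hm
    have hm0 : 0 < m := Nat.floor_pos.2 hx1
    have hmR : (0 : ℝ) < m := by exact_mod_cast hm0
    obtain ⟨Ω, hrank, hclose⟩ := exists_stabilizerRank_le_normSq_sub_le ψ hψ c φ hφ hφ₁ hdec hm0
    have hclose' : Cryptography.normSq (ψ - Ω) ≤ δ ^ 2 := by
      refine hclose.trans ?_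
      rw [div_le_iff₀ hmR]
      have hfl : x < m + 1 := Nat.lt_floor_add_one x
      have hxd : δ ^ 2 * x = L ^ 2 := by
        rw [hx]
        field_simp
      nlinarith
    have happrox : approxStabilizerRank δ ψ ≤ stabilizerRank Ω := Nat.sInf_le ⟨Ω, hclose', rfl⟩
    calc (approxStabilizerRank δ ψ : ℝ) ≤ m := by exact_mod_cast happrox.trans hrank
      _ ≤ x := Nat.floor_le (by positivity)

end Sparsification

end Literature.Computability.QuantumComplexity
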